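import Literature.Analysis.FluidPDE.OnsagerFlexibilityProofs
import Literature.Analysis.FluidPDE.OnsagerBDSVProofs
import Literature.Analysis.FluidPDE.OnsagerBDSVMainReduction
import Literature.Analysis.FluidPDE.OnsagerBDSVGluedStageAssembly
import Literature.Analysis.FluidPDE.OnsagerBDSVNashErrorProof
import Literature.Analysis.FluidPDE.OnsagerBDSVOscillationSplitProofs
import Literature.Analysis.FluidPDE.OnsagerBDSVTransportSplit
import Literature.Analysis.FluidPDE.OnsagerBDSVStressSplit
import HarnessLib

/-!
# Onsager flexibility (BDSV 2019, Thm. 1.1): assembly down to the remaining named facts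

Buckmaster–De Lellis–Székelyhidi–Vicol (BDSV), *Onsager's conjecture for admissible weak
solutions*, Comm. Pure Appl. Math. **72** (2019) 229–274 = arXiv:1701.08678, Thm. 1.1 (arXiv
p. 3): for every `β < 1/3` and every strictly positive smooth energy profile `e` on `[0,T]` there
is a weak solution `v ∈ C^β(T³ × [0,T])` of incompressible Euler with `∫|v(·,t)|² = e(t)` — the
named fact `Literature.Analysis.FluidPDE.onsager_flexibility` of `Onsager.lean`.

The printed proof is "Thm. 1.1 from Prop. 2.1" (§2.2) on top of the main iterative proposition
(Prop. 2.1, §§2.3–6 and App. A–D). In the tree: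

* §2.2 is proved: `onsager_flexibility_of_bdsv : BDSV.mainIteration → BDSV.timeRegularity →
  onsager_flexibility` (`OnsagerFlexibilityProofs.lean`: rescaling (2.9), the iteration from
  `(0,0,0)`, uniform convergence, the weak Euler limit, interpolation for the spatial Hölder
  bound, the energy identity) together with the time-regularity step
  `BDSV.timeRegularity_holds` (`OnsagerBDSVProofs.lean`);
* Prop. 2.1 is reduced (`BDSV.mainIteration_of_remaining`, `OnsagerBDSVMainReduction.lean`) to
  the four named facts `Torus.eulerSmoothShortTime` (short-time smooth Euler solutions on `T³`,
  Majda–Bertozzi 2002, Thm. 3.4), `BDSV.gluingStability` (§3: Cor. 3.2, Props. 3.3–3.4),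
  `BDSV.gluedTripleEstimates` (§4: Props. 4.1–4.4) and `BDSV.stressEstimate` (Prop. 6.1), the
  mollification stage (Prop. 2.2), the propagation half of Prop. 3.1, the assembly of §§2.5–2.6,
  Lemma 5.1, Lemma 5.3, §5.2, §5.4, Cor. 5.8 and Prop. 6.2 being proved;
* of these, §4 is further reduced to the Calderón–Zygmund commutator estimate of App. D
  (`BDSV.gluedTripleEstimates_of_commutatorCZBound`, `OnsagerBDSVGluedStageAssembly.lean`), and
  Prop. 6.1 to the three error estimates of §6.1 (`BDSV.stressEstimate_of_errors`,
  `OnsagerBDSVStressSplit.lean`), of which the Nash error (6.5) is proved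
  (`BDSV.nashErrorEstimate_holds`, `OnsagerBDSVNashErrorProof.lean`), the transport error (6.8)
  is the sum of its two parts (`BDSV.transportErrorEstimate_of_parts`,
  `OnsagerBDSVTransportSplit.lean`) and the oscillation error (6.12) is the sum of (6.11) and the
  proved (6.9) (`BDSV.oscillationErrorEstimate_of_parts`, `BDSV.oscillationCorrectorEstimate_holds`,
  `OnsagerBDSVOscillationSplit(Proofs).lean`).

This file composes these pieces into the two reductions of Thm. 1.1 that express its present
trust base exactly, and certifies that the import closures of the §2.2 assembly
(`OnsagerFlexibilityProofs`, `OnsagerBDSVProofs`) and of the Prop. 2.1 cone are compatible: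

* `onsager_flexibility_of_remaining`: Thm. 1.1 from the four named facts above;
* `onsager_flexibility_of_frontier`: Thm. 1.1 from the six finest outstanding statements —
  `Torus.eulerSmoothShortTime`, `BDSV.gluingStability`, `BDSV.commutatorCZBound` (App. D,
  Prop. D.1), the transport-error bodies for `D_{t,q} w_o` and `D_{t,q} w_c` (§6.1.2, arXiv
  (6.6)–(6.7)) and `BDSV.oscillationPrincipalEstimate` (§6.1.3, arXiv (6.11));

with the dissipative corollaries for `onsager_flexibility_strictAntiOn` (strictly decreasing
profiles, via `onsager_flexibility_strictAntiOn_of` of `Onsager.lean`). When the four facts are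
discharged, `theorem onsager_flexibility_holds : onsager_flexibility :=
onsager_flexibility_of_remaining Torus.eulerSmoothShortTime_holds BDSV.gluingStability_holds
BDSV.gluedTripleEstimates_holds BDSV.stressEstimate_holds`. Nothing new is asserted: every
declaration here is a composition of proved theorems (no named facts are introduced).

## References

* T. Buckmaster, C. De Lellis, L. Székelyhidi Jr., V. Vicol, *Onsager's conjecture for admissible
  weak solutions*, Comm. Pure Appl. Math. 72 (2019) 229–274 = arXiv:1701.08678: Thm. 1.1, §2.2
  ("Proof of Theorem 1.1"), Prop. 2.1 and §2.3–2.6, Prop. 3.1, §3, §4, Prop. 6.1 and §6.1,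
  App. D Prop. D.1. [`BuckmasterEtAl2018`]
* A. J. Majda, A. L. Bertozzi, *Vorticity and incompressible flow*, CUP 2002, Thm. 3.4.
  [`MajdaBertozziCUP2002`]
-/

namespace Literature.Analysis.FluidPDE

/-- **BDSV Thm. 1.1 from the four remaining named facts**: Onsager flexibility
(`onsager_flexibility`: for every `α < 1/3` and every smooth strictly positive energy profile on
`[0,T]` a weak Euler solution on `T³`, `α`-Hölder in space-time, with that kinetic-energy
profile) follows from short-time existence of smooth Euler solutions on `T³`
(`Torus.eulerSmoothShortTime`, Majda–Bertozzi Thm. 3.4), the stability estimates of BDSV §3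
(`BDSV.gluingStability`), the glued-triple estimates of §4 (`BDSV.gluedTripleEstimates`) and the
Reynolds-stress estimate Prop. 6.1 (`BDSV.stressEstimate`): the proved §2.2 assembly
`onsager_flexibility_of_bdsv` fed with Prop. 2.1 in its reduced form
`BDSV.mainIteration_of_remaining` and with the proved time-regularity step
`BDSV.timeRegularity_holds`. [cite: BuckmasterEtAl2018, Thm. 1.1, §2.2 and Prop. 2.1] -/
theorem onsager_flexibility_of_remaining (h₁ : Torus.eulerSmoothShortTime)
    (h₂ : BDSV.gluingStability) (h₃ : BDSV.gluedTripleEstimates) (h₄ : BDSV.stressEstimate) :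
    onsager_flexibility :=
  onsager_flexibility_of_bdsv (BDSV.mainIteration_of_remaining h₁ h₂ h₃ h₄)
    BDSV.timeRegularity_holds

/-- **BDSV Thm. 1.1 from the finest outstanding statements** (the exact present trust base of
`onsager_flexibility`): short-time smooth Euler solutions on `T³` (`Torus.eulerSmoothShortTime`),
the §3 stability estimates (`BDSV.gluingStability`), the Calderón–Zygmund commutator estimate of
App. D, Prop. D.1 (`BDSV.commutatorCZBound`, which gives §4 by
`BDSV.gluedTripleEstimates_of_commutatorCZBound`), the two transport-error bounds of §6.1.2 for
`ℛ(D_{t,q} w_o)` and `ℛ(D_{t,q} w_c)` (arXiv (6.6)–(6.7), the bodies `BDSV.TransportBound` of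
`BDSV.principalTransportSource` / `BDSV.correctorTransportSource` along the common prefix
`BDSV.StageFact`, which give (6.8) by `BDSV.transportErrorEstimate_of_parts`) and the principal
oscillation estimate (6.11) (`BDSV.oscillationPrincipalEstimate`, which with the proved (6.9)
gives (6.12) by `BDSV.oscillationErrorEstimate_of_parts`); Prop. 6.1 then follows by
`BDSV.stressEstimate_of_errors` with the proved Nash error (6.5), `BDSV.nashErrorEstimate_holds`.
[cite: BuckmasterEtAl2018, Thm. 1.1, §2.2, Prop. 2.1, §6.1 and App. D Prop. D.1] -/
theorem onsager_flexibility_of_frontier (h₁ : Torus.eulerSmoothShortTime)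
    (h₂ : BDSV.gluingStability) (h₃ : BDSV.commutatorCZBound)
    (h₄ : BDSV.StageFact (BDSV.TransportBound BDSV.principalTransportSource))
    (h₅ : BDSV.StageFact (BDSV.TransportBound BDSV.correctorTransportSource))
    (h₆ : BDSV.oscillationPrincipalEstimate) : onsager_flexibility :=
  onsager_flexibility_of_remaining h₁ h₂ (BDSV.gluedTripleEstimates_of_commutatorCZBound h₃)
    (BDSV.stressEstimate_of_errors BDSV.nashErrorEstimate_holds
      (BDSV.transportErrorEstimate_of_parts h₄ h₅)
      (BDSV.oscillationErrorEstimate_of_parts h₆ BDSV.oscillationCorrectorEstimate_holds))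

/-- **Dissipative Hölder Euler flows below `1/3` from the four remaining named facts** (BDSV
Thm. 1.1 applied to strictly decreasing profiles, `onsager_flexibility_strictAntiOn`, via
`onsager_flexibility_strictAntiOn_of`). [cite: BuckmasterEtAl2018, Thm. 1.1] -/
theorem onsager_flexibility_strictAntiOn_of_remaining (h₁ : Torus.eulerSmoothShortTime)
    (h₂ : BDSV.gluingStability) (h₃ : BDSV.gluedTripleEstimates) (h₄ : BDSV.stressEstimate) :
    onsager_flexibility_strictAntiOn :=
  onsager_flexibility_strictAntiOn_of (onsager_flexibility_of_remaining h₁ h₂ h₃ h₄)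

/-- **Dissipative Hölder Euler flows below `1/3` from the finest outstanding statements** (as
`onsager_flexibility_of_frontier`, for `onsager_flexibility_strictAntiOn`).
[cite: BuckmasterEtAl2018, Thm. 1.1] -/
theorem onsager_flexibility_strictAntiOn_of_frontier (h₁ : Torus.eulerSmoothShortTime)
    (h₂ : BDSV.gluingStability) (h₃ : BDSV.commutatorCZBound)
    (h₄ : BDSV.StageFact (BDSV.TransportBound BDSV.principalTransportSource))
    (h₅ : BDSV.StageFact (BDSV.TransportBound BDSV.correctorTransportSource))
    (h₆ : BDSV.oscillationPrincipalEstimate) : onsager_flexibility_strictAntiOn :=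
  onsager_flexibility_strictAntiOn_of (onsager_flexibility_of_frontier h₁ h₂ h₃ h₄ h₅ h₆)

end Literature.Analysis.FluidPDE
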